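import Mathlib

/-!
# The `5 × 5` pencil behind LO(4,5) and the slice rank of the `3 × 5` injective pattern: fifteen lines of rank `≤ 2`
# (crux `RankRigidMinimalRepr`, stmt-ValiantsHypothesis-18034; frontier rung `LaplaceOptimalFive`, stmt-24813)

Contracting slots of the injective patterns `P₄,₅` (two slots, second covector `𝟙`) or `P₃,₅` (one slot) against a vector
`t ∈ ℂ⁵` leaves the symmetric zero-diagonal `5 × 5` PENCIL `M(t)(z,w) = [z ≠ w](T - t_z - t_w)`, `T = Σ t` — the one-letter-up
twin of the `4 × 4` pencil of `…LaplaceFourPencil.lean` (`laplaceOptimal_four`).  Every cheap split-rank-one decomposition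
turns, after such a contraction, into «`M(ψ)` is a sum of few rank-one matrices for all `ψ` in a subspace of small
codimension»; this file provides the finite facts about the pencil (matrix-free, explicit entries):

* `symm_rank_one_eq_zero'` — a symmetric zero-diagonal pattern (any index type) which is ONE rank-one product vanishes;
* `pencil5_eq_zero` — `M(t) = 0` only for `t = 0`;
* `pencil5_two_rank_one` — **the fifteen lines**: if `M(t)` is a sum of TWO rank-one products then `t` is a multiple of a
  «star» `𝟙 - 3e_a` (`t_a = -2c`, `t_j = c` otherwise) or of a «matching» `e_a - e_b` (`t` vanishes off `{a,b}`,
  `t_a + t_b = 0`).  Proof: all principal `3 × 3` minors of a two-term sum vanish, i.e. `n_xy n_xz n_yz = 0` on every triangle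
  (`n_xy = T - t_x - t_y`); a PATH `n_xy = n_yw = 0` forces `T = 2t_x` (else the three remaining letters carry equal
  `n`'s with non-zero product, `path_zero`); `n_xy = 0 ∧ T = 2t_x ⟹ T = 2t_y`; the resulting finite implication on `15`
  Boolean atoms is `cover5_bool` (`decide`).  In the coordinates `s_x = T/2 - t_x` (`n_xy = s_x + s_y`) the fifteen lines
  read: four of the `s_x` vanish (star) or three vanish and the other two are opposite (matching);
* `pencil5_plane_not_fifteen_lines` — no `2`-dimensional family `ψ + μψ'` (`ψ, ψ'` independent) stays inside the fifteen
  lines (pigeonhole on sixteen values of `μ`), packaged as `pencil5_two_rank_one_plane`.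

Numerically (seat script pencil5.py, exact arithmetic): rank `M(t) ≤ 3` iff three of the `s_x` vanish or two vanish and the
other three sum to zero (twenty planes), rank `4` on the quintic `(Σs)·e₄(s) = 9e₅(s)` — not needed here.  HONEST FRAMING:
elementary finite linear algebra toward the rung LO(4,5) (`LaplaceOptimalFourFive`, OPEN) of the programme on
`LaplaceOptimalFive` (stmt-24813, OPEN); nothing here bears on `VP ≠ VNP`.
-/

set_option autoImplicit false

-- the mandated summit-side namespace repeats a component by design (single-problem summit)
set_option linter.dupNamespace false

namespace Summit.ValiantsHypothesis.ValiantsHypothesis.Theorems.RigidityForcesSymmetryRankRigidMinimalRepr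

namespace Pencil5

open Finset

/-! ### §1 One rank-one product, and injectivity of the pencil -/

/-- A symmetric zero-diagonal pattern which is a single rank-one product `a_z b_w` vanishes identically:
`n_zw² = (a_z b_w)(a_w b_z) = (a_z b_z)(a_w b_w) = 0`. -/
theorem symm_rank_one_eq_zero' {ι : Type*} (n : ι → ι → ℂ) (a b : ι → ℂ)
    (hsymm : ∀ z w, n z w = n w z) (hdiag : ∀ z, n z z = 0) (h : ∀ z w, n z w = a z * b w) :
    ∀ z w, n z w = 0 := by
  intro z w
  have h1 : n z w * n z w = (a z * b z) * (a w * b w) := by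
    have e1 : n z w = a z * b w := h z w
    have e2 : n z w = a w * b z := (hsymm z w).trans (h w z)
    calc n z w * n z w = (a z * b w) * (a w * b z) := by rw [← e1, ← e2]
      _ = (a z * b z) * (a w * b w) := by ring
  rw [← h z z, ← h w w, hdiag z, zero_mul] at h1
  exact mul_self_eq_zero.1 h1

/-- `M(t) = 0` forces `t = 0`: from `n_xy = n_xz = n_yz = 0` the letters `x, y, z` carry `T/2`; all five do, and then
`T = 5T/2`. -/
theorem pencil5_eq_zero (t : Fin 5 → ℂ) (h : ∀ z w : Fin 5, z ≠ w → (∑ i, t i) - t z - t w = 0) : t = 0 := by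
  have hS : ∑ i, t i = t 0 + t 1 + t 2 + t 3 + t 4 := Fin.sum_univ_five t
  have h01 := h 0 1 (by decide)
  have h02 := h 0 2 (by decide)
  have h03 := h 0 3 (by decide)
  have h04 := h 0 4 (by decide)
  have h12 := h 1 2 (by decide)
  have h13 := h 1 3 (by decide)
  have h14 := h 1 4 (by decide)
  have h23 := h 2 3 (by decide)
  have h24 := h 2 4 (by decide)
  have h34 := h 3 4 (by decide)
  funext i
  fin_cases i
  · show t 0 = 0
    linear_combination (-1/6 : ℂ) * (h01 + h02) + (1/2 : ℂ) * h12 - (1/6 : ℂ) * (h03 + h04) + (1/2 : ℂ) * h34 -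
      (1/3 : ℂ) * hS
  · show t 1 = 0
    linear_combination (-1/6 : ℂ) * (h01 + h12) + (1/2 : ℂ) * h02 - (1/6 : ℂ) * (h13 + h14) + (1/2 : ℂ) * h34 -
      (1/3 : ℂ) * hS
  · show t 2 = 0
    linear_combination (-1/6 : ℂ) * (h02 + h12) + (1/2 : ℂ) * h01 - (1/6 : ℂ) * (h23 + h24) + (1/2 : ℂ) * h34 -
      (1/3 : ℂ) * hS
  · show t 3 = 0
    linear_combination (-1/6 : ℂ) * (h03 + h13) + (1/2 : ℂ) * h01 - (1/6 : ℂ) * (h23 + h34) + (1/2 : ℂ) * h24 -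
      (1/3 : ℂ) * hS
  · show t 4 = 0
    linear_combination (-1/6 : ℂ) * (h04 + h14) + (1/2 : ℂ) * h01 - (1/6 : ℂ) * (h24 + h34) + (1/2 : ℂ) * h23 -
      (1/3 : ℂ) * hS

/-! ### §2 Two rank-one products: the fifteen lines -/

/-- Every `3 × 3` minor of a sum of two rank-one products vanishes (Cauchy–Binet), written out. -/
theorem det3_two_rank_one5 (N : Fin 5 → Fin 5 → ℂ) (a b a' b' : Fin 5 → ℂ)
    (hN : ∀ z w, N z w = a z * b w + a' z * b' w) (r₁ r₂ r₃ c₁ c₂ c₃ : Fin 5) :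
    N r₁ c₁ * (N r₂ c₂ * N r₃ c₃ - N r₂ c₃ * N r₃ c₂) - N r₁ c₂ * (N r₂ c₁ * N r₃ c₃ - N r₂ c₃ * N r₃ c₁)
      + N r₁ c₃ * (N r₂ c₁ * N r₃ c₂ - N r₂ c₂ * N r₃ c₁) = 0 := by
  simp only [hN]; ring

/-- A product of three factors vanishes only if a factor does. -/
theorem or3_of_mul3 {x y z : ℂ} (h : x * y * z = 0) : x = 0 ∨ y = 0 ∨ z = 0 := by
  rcases mul_eq_zero.1 h with hxy | hz
  · rcases mul_eq_zero.1 hxy with hx | hy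
    · exact Or.inl hx
    · exact Or.inr (Or.inl hy)
  · exact Or.inr (Or.inr hz)

/-- The principal `3 × 3` minor of a two-term sum on a triangle `{x,y,w}`: `n_xy n_xw n_yw = 0`. -/
theorem tri_prod (t a b a' b' : Fin 5 → ℂ)
    (h : ∀ z w : Fin 5, (if z = w then (0 : ℂ) else (∑ i, t i) - t z - t w) = a z * b w + a' z * b' w)
    (x y w : Fin 5) (hxy : x ≠ y) (hxw : x ≠ w) (hyw : y ≠ w) :
    ((∑ i, t i) - t x - t y) * ((∑ i, t i) - t x - t w) * ((∑ i, t i) - t y - t w) = 0 := by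
  have m := det3_two_rank_one5 (fun z w : Fin 5 => if z = w then (0 : ℂ) else (∑ i, t i) - t z - t w)
    a b a' b' h x y w x y w
  simp only [if_true, if_neg hxy, if_neg hxw, if_neg hyw, if_neg hxy.symm, if_neg hxw.symm, if_neg hyw.symm] at m
  linear_combination (1/2 : ℂ) * m

/-- **PATH lemma.**  With `n_xy = T - t_x - t_y`: if `n_xy = n_yw = 0` (so `t_x = t_w`) and the principal products on the
triangles `{x,w,a}`, `{x,w,b}`, `{y,a,b}` vanish, then `T = 2t_x` — otherwise `n_xw ≠ 0` forces `t_a = t_b = t_y = T - t_x` and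
the triangle `{y,a,b}` has product `(2t_x - T)³ ≠ 0`.  (Indices need not be distinct.) -/
theorem path_zero (t : Fin 5 → ℂ) (x y w a b : Fin 5)
    (hxy : (∑ i, t i) - t x - t y = 0) (hyw : (∑ i, t i) - t y - t w = 0)
    (Pa : ((∑ i, t i) - t x - t w) * ((∑ i, t i) - t x - t a) * ((∑ i, t i) - t w - t a) = 0)
    (Pb : ((∑ i, t i) - t x - t w) * ((∑ i, t i) - t x - t b) * ((∑ i, t i) - t w - t b) = 0)
    (Pyab : ((∑ i, t i) - t y - t a) * ((∑ i, t i) - t y - t b) * ((∑ i, t i) - t a - t b) = 0) :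
    (∑ i, t i) - 2 * t x = 0 := by
  by_contra hx
  have hw : t w = t x := by linear_combination hxy - hyw
  have hxw : (∑ i, t i) - t x - t w ≠ 0 := fun e => hx (by linear_combination e + hxy - hyw)
  have ha : (∑ i, t i) - t x - t a = 0 := by
    rcases or3_of_mul3 Pa with e | e | e
    · exact absurd e hxw
    · exact e
    · linear_combination e + hxy - hyw
  have hb : (∑ i, t i) - t x - t b = 0 := by
    rcases or3_of_mul3 Pb with e | e | e
    · exact absurd e hxw
    · exact e
    · linear_combination e + hxy - hyw
  have key : ((∑ i, t i) - 2 * t x) ^ 3 = 0 := by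
    have e1 : (∑ i, t i) - t y - t a = -((∑ i, t i) - 2 * t x) := by linear_combination ha + hxy
    have e2 : (∑ i, t i) - t y - t b = -((∑ i, t i) - 2 * t x) := by linear_combination hb + hxy
    have e3 : (∑ i, t i) - t a - t b = -((∑ i, t i) - 2 * t x) := by linear_combination ha + hb
    rw [e1, e2, e3] at Pyab
    linear_combination -Pyab
  exact hx (pow_eq_zero_iff (by norm_num) |>.1 key)

/-- The combinatorial core in Boolean form (by `decide` over `2¹⁵` assignments): atoms `zxy` = «`n_xy = 0`»,
`ux` = «`T = 2t_x`»; hypotheses = the ten TRIANGLE clauses (principal minors), the thirty PATH clauses (`path_zero`) and the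
twenty PROPAGATION clauses (`n_xy = 0`, `T = 2t_x` ⟹ `T = 2t_y`); conclusion = one of the five STARS (`T = 2t_x` for all
`x ≠ a`) or ten MATCHINGS (`n_ab = 0` and `T = 2t_c` for `c ∉ {a,b}`). -/
theorem cover5_bool : ∀ z01 z02 z03 z04 z12 z13 z14 z23 z24 z34 u0 u1 u2 u3 u4 : Bool,
    ((z01 || z02 || z12) && ((z01 || z03 || z13) && ((z01 || z04 || z14) && ((z02 || z03 || z23) && ((z02 || z04 || z24) && ((z03 || z04 || z34) && ((z12 || z13 || z23) && ((z12 || z14 || z24) && ((z13 || z14 || z34) && ((z23 || z24 || z34) && ((!(z01 && z02) || u1) && ((!(z01 && z03) || u1) && ((!(z01 && z04) || u1) && ((!(z02 && z03) || u2) && ((!(z02 && z04) || u2) && ((!(z03 && z04) || u3) && ((!(z01 && z12) || u0) && ((!(z01 && z13) || u0) && ((!(z01 && z14) || u0) && ((!(z12 && z13) || u2) && ((!(z12 && z14) || u2) && ((!(z13 && z14) || u3) && ((!(z02 && z12) || u0) && ((!(z02 && z23) || u0) && ((!(z02 && z24) || u0) && ((!(z12 && z23) || u1) && ((!(z12 &&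 z24) || u1) && ((!(z23 && z24) || u3) && ((!(z03 && z13) || u0) && ((!(z03 && z23) || u0) && ((!(z03 && z34) || u0) && ((!(z13 && z23) || u1) && ((!(z13 && z34) || u1) && ((!(z23 && z34) || u2) && ((!(z04 && z14) || u0) && ((!(z04 && z24) || u0) && ((!(z04 && z34) || u0) && ((!(z14 && z24) || u1) && ((!(z14 && z34) || u1) && ((!(z24 && z34) || u2) && ((!(z01 && u0) || u1) && ((!(z02 && u0) || u2) && ((!(z03 && u0) || u3) && ((!(z04 && u0) || u4) && ((!(z01 && u1) || u0) && ((!(z12 && u1) || u2) && ((!(z13 && u1) || u3) && ((!(z14 && u1) || u4) && ((!(z02 && u2) || u0) && ((!(z12 && u2) || u1) && ((!(z23 && u2) || u3) && ((!(z24 && u2) || u4) && ((!(z03 && u3) || u0) && ((!(z13 && u3) || u1) && ((!(z23 && u3) || u2) && ((!(z34 && u3) || u4) && ((!(z04 && u4) || u0) && ((!(z14 && u4) || u1) && ((!(z24 && u4) || u2) && (!(z34 && u4) || u3)))))))))))))))))))))))))))))))))))))))))))))))))))))))))))) = true →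
    ((u1 && (u2 && (u3 && u4))) || ((u0 && (u2 && (u3 && u4))) || ((u0 && (u1 && (u3 && u4))) || ((u0 && (u1 && (u2 && u4))) || ((u0 && (u1 && (u2 && u3))) || ((z01 && (u2 && (u3 && u4))) || ((z02 && (u1 && (u3 && u4))) || ((z03 && (u1 && (u2 && u4))) || ((z04 && (u1 && (u2 && u3))) || ((z12 && (u0 && (u3 && u4))) || ((z13 && (u0 && (u2 && u4))) || ((z14 && (u0 && (u2 && u3))) || ((z23 && (u0 && (u1 && u4))) || ((z24 && (u0 && (u1 && u3))) || (z34 && (u0 && (u1 && u2))))))))))))))))) = true := by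
  decide +kernel

set_option maxHeartbeats 800000 in
/-- **The fifteen lines.**  If the pencil `M(t)(z,w) = [z ≠ w](T - t_z - t_w)`, `T = Σ t`, is a sum of two rank-one
products, then `t` is a multiple of a STAR `𝟙 - 3e_a` (`t_a = -2c`, `t_j = c` for `j ≠ a`) or of a MATCHING `e_a - e_b`
(`t` vanishes off `{a,b}`, `a ≠ b`, and `t_a + t_b = 0`). -/
theorem pencil5_two_rank_one (t a b a' b' : Fin 5 → ℂ)
    (h : ∀ z w : Fin 5, (if z = w then (0 : ℂ) else (∑ i, t i) - t z - t w) = a z * b w + a' z * b' w) :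
    (∃ x : Fin 5, ∃ c : ℂ, t x = -2 * c ∧ ∀ j, j ≠ x → t j = c) ∨
    (∃ x y : Fin 5, x ≠ y ∧ (∀ k, k ≠ x → k ≠ y → t k = 0) ∧ t x + t y = 0) := by
  have tob3 : ∀ {P Q R : Prop} [Decidable P] [Decidable Q] [Decidable R], P ∨ Q ∨ R →
      (decide P || decide Q || decide R) = true := by
    intro P Q R _ _ _ hPQR; rcases hPQR with hP | hQ | hR <;> simp [*]
  have tobI : ∀ {P Q R : Prop} [Decidable P] [Decidable Q] [Decidable R], (P → Q → R) →
      (!(decide P && decide Q) || decide R) = true := by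
    intro P Q R _ _ _ hPQR; by_cases hP : P <;> by_cases hQ : Q <;> simp [hP, hQ, hPQR]
  have hS : ∑ i, t i = t 0 + t 1 + t 2 + t 3 + t 4 := Fin.sum_univ_five t
  have p012 := tri_prod t a b a' b' h 0 1 2 (by decide) (by decide) (by decide)
  have p013 := tri_prod t a b a' b' h 0 1 3 (by decide) (by decide) (by decide)
  have p014 := tri_prod t a b a' b' h 0 1 4 (by decide) (by decide) (by decide)
  have p023 := tri_prod t a b a' b' h 0 2 3 (by decide) (by decide) (by decide)
  have p024 := tri_prod t a b a' b' h 0 2 4 (by decide) (by decide) (by decide)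
  have p034 := tri_prod t a b a' b' h 0 3 4 (by decide) (by decide) (by decide)
  have p123 := tri_prod t a b a' b' h 1 2 3 (by decide) (by decide) (by decide)
  have p124 := tri_prod t a b a' b' h 1 2 4 (by decide) (by decide) (by decide)
  have p134 := tri_prod t a b a' b' h 1 3 4 (by decide) (by decide) (by decide)
  have p234 := tri_prod t a b a' b' h 2 3 4 (by decide) (by decide) (by decide)
  have c102 : ((∑ i, t i) - t 0 - t 1) = 0 → ((∑ i, t i) - t 0 - t 2) = 0 → (∑ i, t i) - 2 * t 1 = 0 := fun h1 h2 =>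
    path_zero t 1 0 2 3 4 (by linear_combination h1) (by linear_combination h2) (by linear_combination p123) (by linear_combination p124)
      (by linear_combination p034)
  have c103 : ((∑ i, t i) - t 0 - t 1) = 0 → ((∑ i, t i) - t 0 - t 3) = 0 → (∑ i, t i) - 2 * t 1 = 0 := fun h1 h2 =>
    path_zero t 1 0 3 2 4 (by linear_combination h1) (by linear_combination h2) (by linear_combination p123) (by linear_combination p134)
      (by linear_combination p024)
  have c104 : ((∑ i, t i) - t 0 - t 1) = 0 → ((∑ i, t i) - t 0 - t 4) = 0 → (∑ i, t i) - 2 * t 1 = 0 := fun h1 h2 =>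
    path_zero t 1 0 4 2 3 (by linear_combination h1) (by linear_combination h2) (by linear_combination p124) (by linear_combination p134)
      (by linear_combination p023)
  have c203 : ((∑ i, t i) - t 0 - t 2) = 0 → ((∑ i, t i) - t 0 - t 3) = 0 → (∑ i, t i) - 2 * t 2 = 0 := fun h1 h2 =>
    path_zero t 2 0 3 1 4 (by linear_combination h1) (by linear_combination h2) (by linear_combination p123) (by linear_combination p234)
      (by linear_combination p014)
  have c204 : ((∑ i, t i) - t 0 - t 2) = 0 → ((∑ i, t i) - t 0 - t 4) = 0 → (∑ i, t i) - 2 * t 2 = 0 := fun h1 h2 =>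
    path_zero t 2 0 4 1 3 (by linear_combination h1) (by linear_combination h2) (by linear_combination p124) (by linear_combination p234)
      (by linear_combination p013)
  have c304 : ((∑ i, t i) - t 0 - t 3) = 0 → ((∑ i, t i) - t 0 - t 4) = 0 → (∑ i, t i) - 2 * t 3 = 0 := fun h1 h2 =>
    path_zero t 3 0 4 1 2 (by linear_combination h1) (by linear_combination h2) (by linear_combination p134) (by linear_combination p234)
      (by linear_combination p012)
  have c012 : ((∑ i, t i) - t 0 - t 1) = 0 → ((∑ i, t i) - t 1 - t 2) = 0 → (∑ i, t i) - 2 * t 0 = 0 := fun h1 h2 =>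
    path_zero t 0 1 2 3 4 (by linear_combination h1) (by linear_combination h2) (by linear_combination p023) (by linear_combination p024)
      (by linear_combination p134)
  have c013 : ((∑ i, t i) - t 0 - t 1) = 0 → ((∑ i, t i) - t 1 - t 3) = 0 → (∑ i, t i) - 2 * t 0 = 0 := fun h1 h2 =>
    path_zero t 0 1 3 2 4 (by linear_combination h1) (by linear_combination h2) (by linear_combination p023) (by linear_combination p034)
      (by linear_combination p124)
  have c014 : ((∑ i, t i) - t 0 - t 1) = 0 → ((∑ i, t i) - t 1 - t 4) = 0 → (∑ i, t i) - 2 * t 0 = 0 := fun h1 h2 =>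
    path_zero t 0 1 4 2 3 (by linear_combination h1) (by linear_combination h2) (by linear_combination p024) (by linear_combination p034)
      (by linear_combination p123)
  have c213 : ((∑ i, t i) - t 1 - t 2) = 0 → ((∑ i, t i) - t 1 - t 3) = 0 → (∑ i, t i) - 2 * t 2 = 0 := fun h1 h2 =>
    path_zero t 2 1 3 0 4 (by linear_combination h1) (by linear_combination h2) (by linear_combination p023) (by linear_combination p234)
      (by linear_combination p014)
  have c214 : ((∑ i, t i) - t 1 - t 2) = 0 → ((∑ i, t i) - t 1 - t 4) = 0 → (∑ i, t i) - 2 * t 2 = 0 := fun h1 h2 =>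
    path_zero t 2 1 4 0 3 (by linear_combination h1) (by linear_combination h2) (by linear_combination p024) (by linear_combination p234)
      (by linear_combination p013)
  have c314 : ((∑ i, t i) - t 1 - t 3) = 0 → ((∑ i, t i) - t 1 - t 4) = 0 → (∑ i, t i) - 2 * t 3 = 0 := fun h1 h2 =>
    path_zero t 3 1 4 0 2 (by linear_combination h1) (by linear_combination h2) (by linear_combination p034) (by linear_combination p234)
      (by linear_combination p012)
  have c021 : ((∑ i, t i) - t 0 - t 2) = 0 → ((∑ i, t i) - t 1 - t 2) = 0 → (∑ i, t i) - 2 * t 0 = 0 := fun h1 h2 =>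
    path_zero t 0 2 1 3 4 (by linear_combination h1) (by linear_combination h2) (by linear_combination p013) (by linear_combination p014)
      (by linear_combination p234)
  have c023 : ((∑ i, t i) - t 0 - t 2) = 0 → ((∑ i, t i) - t 2 - t 3) = 0 → (∑ i, t i) - 2 * t 0 = 0 := fun h1 h2 =>
    path_zero t 0 2 3 1 4 (by linear_combination h1) (by linear_combination h2) (by linear_combination p013) (by linear_combination p034)
      (by linear_combination p124)
  have c024 : ((∑ i, t i) - t 0 - t 2) = 0 → ((∑ i, t i) - t 2 - t 4) = 0 → (∑ i, t i) - 2 * t 0 = 0 := fun h1 h2 =>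
    path_zero t 0 2 4 1 3 (by linear_combination h1) (by linear_combination h2) (by linear_combination p014) (by linear_combination p034)
      (by linear_combination p123)
  have c123 : ((∑ i, t i) - t 1 - t 2) = 0 → ((∑ i, t i) - t 2 - t 3) = 0 → (∑ i, t i) - 2 * t 1 = 0 := fun h1 h2 =>
    path_zero t 1 2 3 0 4 (by linear_combination h1) (by linear_combination h2) (by linear_combination p013) (by linear_combination p134)
      (by linear_combination p024)
  have c124 : ((∑ i, t i) - t 1 - t 2) = 0 → ((∑ i, t i) - t 2 - t 4) = 0 → (∑ i, t i) - 2 * t 1 = 0 := fun h1 h2 =>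
    path_zero t 1 2 4 0 3 (by linear_combination h1) (by linear_combination h2) (by linear_combination p014) (by linear_combination p134)
      (by linear_combination p023)
  have c324 : ((∑ i, t i) - t 2 - t 3) = 0 → ((∑ i, t i) - t 2 - t 4) = 0 → (∑ i, t i) - 2 * t 3 = 0 := fun h1 h2 =>
    path_zero t 3 2 4 0 1 (by linear_combination h1) (by linear_combination h2) (by linear_combination p034) (by linear_combination p134)
      (by linear_combination p012)
  have c031 : ((∑ i, t i) - t 0 - t 3) = 0 → ((∑ i, t i) - t 1 - t 3) = 0 → (∑ i, t i) - 2 * t 0 = 0 := fun h1 h2 =>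
    path_zero t 0 3 1 2 4 (by linear_combination h1) (by linear_combination h2) (by linear_combination p012) (by linear_combination p014)
      (by linear_combination p234)
  have c032 : ((∑ i, t i) - t 0 - t 3) = 0 → ((∑ i, t i) - t 2 - t 3) = 0 → (∑ i, t i) - 2 * t 0 = 0 := fun h1 h2 =>
    path_zero t 0 3 2 1 4 (by linear_combination h1) (by linear_combination h2) (by linear_combination p012) (by linear_combination p024)
      (by linear_combination p134)
  have c034 : ((∑ i, t i) - t 0 - t 3) = 0 → ((∑ i, t i) - t 3 - t 4) = 0 → (∑ i, t i) - 2 * t 0 = 0 := fun h1 h2 =>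
    path_zero t 0 3 4 1 2 (by linear_combination h1) (by linear_combination h2) (by linear_combination p014) (by linear_combination p024)
      (by linear_combination p123)
  have c132 : ((∑ i, t i) - t 1 - t 3) = 0 → ((∑ i, t i) - t 2 - t 3) = 0 → (∑ i, t i) - 2 * t 1 = 0 := fun h1 h2 =>
    path_zero t 1 3 2 0 4 (by linear_combination h1) (by linear_combination h2) (by linear_combination p012) (by linear_combination p124)
      (by linear_combination p034)
  have c134 : ((∑ i, t i) - t 1 - t 3) = 0 → ((∑ i, t i) - t 3 - t 4) = 0 → (∑ i, t i) - 2 * t 1 = 0 := fun h1 h2 =>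
    path_zero t 1 3 4 0 2 (by linear_combination h1) (by linear_combination h2) (by linear_combination p014) (by linear_combination p124)
      (by linear_combination p023)
  have c234 : ((∑ i, t i) - t 2 - t 3) = 0 → ((∑ i, t i) - t 3 - t 4) = 0 → (∑ i, t i) - 2 * t 2 = 0 := fun h1 h2 =>
    path_zero t 2 3 4 0 1 (by linear_combination h1) (by linear_combination h2) (by linear_combination p024) (by linear_combination p124)
      (by linear_combination p013)
  have c041 : ((∑ i, t i) - t 0 - t 4) = 0 → ((∑ i, t i) - t 1 - t 4) = 0 → (∑ i, t i) - 2 * t 0 = 0 := fun h1 h2 =>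
    path_zero t 0 4 1 2 3 (by linear_combination h1) (by linear_combination h2) (by linear_combination p012) (by linear_combination p013)
      (by linear_combination p234)
  have c042 : ((∑ i, t i) - t 0 - t 4) = 0 → ((∑ i, t i) - t 2 - t 4) = 0 → (∑ i, t i) - 2 * t 0 = 0 := fun h1 h2 =>
    path_zero t 0 4 2 1 3 (by linear_combination h1) (by linear_combination h2) (by linear_combination p012) (by linear_combination p023)
      (by linear_combination p134)
  have c043 : ((∑ i, t i) - t 0 - t 4) = 0 → ((∑ i, t i) - t 3 - t 4) = 0 → (∑ i, t i) - 2 * t 0 = 0 := fun h1 h2 =>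
    path_zero t 0 4 3 1 2 (by linear_combination h1) (by linear_combination h2) (by linear_combination p013) (by linear_combination p023)
      (by linear_combination p124)
  have c142 : ((∑ i, t i) - t 1 - t 4) = 0 → ((∑ i, t i) - t 2 - t 4) = 0 → (∑ i, t i) - 2 * t 1 = 0 := fun h1 h2 =>
    path_zero t 1 4 2 0 3 (by linear_combination h1) (by linear_combination h2) (by linear_combination p012) (by linear_combination p123)
      (by linear_combination p034)
  have c143 : ((∑ i, t i) - t 1 - t 4) = 0 → ((∑ i, t i) - t 3 - t 4) = 0 → (∑ i, t i) - 2 * t 1 = 0 := fun h1 h2 =>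
    path_zero t 1 4 3 0 2 (by linear_combination h1) (by linear_combination h2) (by linear_combination p013) (by linear_combination p123)
      (by linear_combination p024)
  have c243 : ((∑ i, t i) - t 2 - t 4) = 0 → ((∑ i, t i) - t 3 - t 4) = 0 → (∑ i, t i) - 2 * t 2 = 0 := fun h1 h2 =>
    path_zero t 2 4 3 0 1 (by linear_combination h1) (by linear_combination h2) (by linear_combination p023) (by linear_combination p123)
      (by linear_combination p014)
  have r01 : ((∑ i, t i) - t 0 - t 1) = 0 → (∑ i, t i) - 2 * t 0 = 0 → (∑ i, t i) - 2 * t 1 = 0 := fun h1 h2 => by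
    linear_combination 2 * h1 - h2
  have r02 : ((∑ i, t i) - t 0 - t 2) = 0 → (∑ i, t i) - 2 * t 0 = 0 → (∑ i, t i) - 2 * t 2 = 0 := fun h1 h2 => by
    linear_combination 2 * h1 - h2
  have r03 : ((∑ i, t i) - t 0 - t 3) = 0 → (∑ i, t i) - 2 * t 0 = 0 → (∑ i, t i) - 2 * t 3 = 0 := fun h1 h2 => by
    linear_combination 2 * h1 - h2
  have r04 : ((∑ i, t i) - t 0 - t 4) = 0 → (∑ i, t i) - 2 * t 0 = 0 → (∑ i, t i) - 2 * t 4 = 0 := fun h1 h2 => by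
    linear_combination 2 * h1 - h2
  have r10 : ((∑ i, t i) - t 0 - t 1) = 0 → (∑ i, t i) - 2 * t 1 = 0 → (∑ i, t i) - 2 * t 0 = 0 := fun h1 h2 => by
    linear_combination 2 * h1 - h2
  have r12 : ((∑ i, t i) - t 1 - t 2) = 0 → (∑ i, t i) - 2 * t 1 = 0 → (∑ i, t i) - 2 * t 2 = 0 := fun h1 h2 => by
    linear_combination 2 * h1 - h2
  have r13 : ((∑ i, t i) - t 1 - t 3) = 0 → (∑ i, t i) - 2 * t 1 = 0 → (∑ i, t i) - 2 * t 3 = 0 := fun h1 h2 => by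
    linear_combination 2 * h1 - h2
  have r14 : ((∑ i, t i) - t 1 - t 4) = 0 → (∑ i, t i) - 2 * t 1 = 0 → (∑ i, t i) - 2 * t 4 = 0 := fun h1 h2 => by
    linear_combination 2 * h1 - h2
  have r20 : ((∑ i, t i) - t 0 - t 2) = 0 → (∑ i, t i) - 2 * t 2 = 0 → (∑ i, t i) - 2 * t 0 = 0 := fun h1 h2 => by
    linear_combination 2 * h1 - h2
  have r21 : ((∑ i, t i) - t 1 - t 2) = 0 → (∑ i, t i) - 2 * t 2 = 0 → (∑ i, t i) - 2 * t 1 = 0 := fun h1 h2 => by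
    linear_combination 2 * h1 - h2
  have r23 : ((∑ i, t i) - t 2 - t 3) = 0 → (∑ i, t i) - 2 * t 2 = 0 → (∑ i, t i) - 2 * t 3 = 0 := fun h1 h2 => by
    linear_combination 2 * h1 - h2
  have r24 : ((∑ i, t i) - t 2 - t 4) = 0 → (∑ i, t i) - 2 * t 2 = 0 → (∑ i, t i) - 2 * t 4 = 0 := fun h1 h2 => by
    linear_combination 2 * h1 - h2
  have r30 : ((∑ i, t i) - t 0 - t 3) = 0 → (∑ i, t i) - 2 * t 3 = 0 → (∑ i, t i) - 2 * t 0 = 0 := fun h1 h2 => by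
    linear_combination 2 * h1 - h2
  have r31 : ((∑ i, t i) - t 1 - t 3) = 0 → (∑ i, t i) - 2 * t 3 = 0 → (∑ i, t i) - 2 * t 1 = 0 := fun h1 h2 => by
    linear_combination 2 * h1 - h2
  have r32 : ((∑ i, t i) - t 2 - t 3) = 0 → (∑ i, t i) - 2 * t 3 = 0 → (∑ i, t i) - 2 * t 2 = 0 := fun h1 h2 => by
    linear_combination 2 * h1 - h2
  have r34 : ((∑ i, t i) - t 3 - t 4) = 0 → (∑ i, t i) - 2 * t 3 = 0 → (∑ i, t i) - 2 * t 4 = 0 := fun h1 h2 => by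
    linear_combination 2 * h1 - h2
  have r40 : ((∑ i, t i) - t 0 - t 4) = 0 → (∑ i, t i) - 2 * t 4 = 0 → (∑ i, t i) - 2 * t 0 = 0 := fun h1 h2 => by
    linear_combination 2 * h1 - h2
  have r41 : ((∑ i, t i) - t 1 - t 4) = 0 → (∑ i, t i) - 2 * t 4 = 0 → (∑ i, t i) - 2 * t 1 = 0 := fun h1 h2 => by
    linear_combination 2 * h1 - h2
  have r42 : ((∑ i, t i) - t 2 - t 4) = 0 → (∑ i, t i) - 2 * t 4 = 0 → (∑ i, t i) - 2 * t 2 = 0 := fun h1 h2 => by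
    linear_combination 2 * h1 - h2
  have r43 : ((∑ i, t i) - t 3 - t 4) = 0 → (∑ i, t i) - 2 * t 4 = 0 → (∑ i, t i) - 2 * t 3 = 0 := fun h1 h2 => by
    linear_combination 2 * h1 - h2
  have cov := cover5_bool (decide (((∑ i, t i) - t 0 - t 1) = 0)) (decide (((∑ i, t i) - t 0 - t 2) = 0)) (decide (((∑ i, t i) - t 0 - t 3) = 0)) (decide (((∑ i, t i) - t 0 - t 4) = 0))
    (decide (((∑ i, t i) - t 1 - t 2) = 0)) (decide (((∑ i, t i) - t 1 - t 3) = 0)) (decide (((∑ i, t i) - t 1 - t 4) = 0)) (decide (((∑ i, t i) - t 2 - t 3) = 0))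
    (decide (((∑ i, t i) - t 2 - t 4) = 0)) (decide (((∑ i, t i) - t 3 - t 4) = 0)) (decide ((∑ i, t i) - 2 * t 0 = 0)) (decide ((∑ i, t i) - 2 * t 1 = 0))
    (decide ((∑ i, t i) - 2 * t 2 = 0)) (decide ((∑ i, t i) - 2 * t 3 = 0)) (decide ((∑ i, t i) - 2 * t 4 = 0))
    (by simp only [Bool.and_eq_true]; exact ⟨tob3 (or3_of_mul3 p012), tob3 (or3_of_mul3 p013), tob3 (or3_of_mul3 p014), tob3 (or3_of_mul3 p023), tob3 (or3_of_mul3 p024), tob3 (or3_of_mul3 p034), tob3 (or3_of_mul3 p123), tob3 (or3_of_mul3 p124), tob3 (or3_of_mul3 p134), tob3 (or3_of_mul3 p234), tobI c102, tobI c103, tobI c104, tobI c203, tobI c204, tobI c304, tobI c012, tobI c013, tobI c014, tobI c213, tobI c214, tobI c314, tobI c021, tobI c023, tobI c024, tobI c123, tobI c124, tobI c324, tobI c031, tobI c032, tobI c034, tobI c132, tobI c134, tobI c234, tobI c041, tobI c042, tobI c043, tobI c142, tobI c143, tobI c243, tobI r01, tobI r02, tobI r03, tobI r04, tobI r10, tobI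 r12, tobI r13, tobI r14, tobI r20, tobI r21, tobI r23, tobI r24, tobI r30, tobI r31, tobI r32, tobI r34, tobI r40, tobI r41, tobI r42, tobI r43⟩)
  simp only [Bool.or_eq_true, Bool.and_eq_true, decide_eq_true_eq] at cov
  have key : (∃ x : Fin 5, ∀ j, j ≠ x → (∑ i, t i) - 2 * t j = 0) ∨
      (∃ x y : Fin 5, x ≠ y ∧ (∑ i, t i) - t x - t y = 0 ∧ ∀ k, k ≠ x → k ≠ y → (∑ i, t i) - 2 * t k = 0) := by
    rcases cov with h0 | h1 | h2 | h3 | h4 | h5 | h6 | h7 | h8 | h9 | h10 | h11 | h12 | h13 | h14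
    · obtain ⟨e1, e2, e3, e4⟩ := h0
      exact Or.inl ⟨0, fun j hj => by fin_cases j <;> first | exact absurd rfl hj | assumption⟩
    · obtain ⟨e1, e2, e3, e4⟩ := h1
      exact Or.inl ⟨1, fun j hj => by fin_cases j <;> first | exact absurd rfl hj | assumption⟩
    · obtain ⟨e1, e2, e3, e4⟩ := h2
      exact Or.inl ⟨2, fun j hj => by fin_cases j <;> first | exact absurd rfl hj | assumption⟩
    · obtain ⟨e1, e2, e3, e4⟩ := h3
      exact Or.inl ⟨3, fun j hj => by fin_cases j <;> first | exact absurd rfl hj | assumption⟩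
    · obtain ⟨e1, e2, e3, e4⟩ := h4
      exact Or.inl ⟨4, fun j hj => by fin_cases j <;> first | exact absurd rfl hj | assumption⟩
    · obtain ⟨hz, e1, e2, e3⟩ := h5
      exact Or.inr ⟨0, 1, by decide, hz, fun k hk1 hk2 => by
        fin_cases k <;> first | exact absurd rfl hk1 | exact absurd rfl hk2 | assumption⟩
    · obtain ⟨hz, e1, e2, e3⟩ := h6
      exact Or.inr ⟨0, 2, by decide, hz, fun k hk1 hk2 => by
        fin_cases k <;> first | exact absurd rfl hk1 | exact absurd rfl hk2 | assumption⟩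
    · obtain ⟨hz, e1, e2, e3⟩ := h7
      exact Or.inr ⟨0, 3, by decide, hz, fun k hk1 hk2 => by
        fin_cases k <;> first | exact absurd rfl hk1 | exact absurd rfl hk2 | assumption⟩
    · obtain ⟨hz, e1, e2, e3⟩ := h8
      exact Or.inr ⟨0, 4, by decide, hz, fun k hk1 hk2 => by
        fin_cases k <;> first | exact absurd rfl hk1 | exact absurd rfl hk2 | assumption⟩
    · obtain ⟨hz, e1, e2, e3⟩ := h9
      exact Or.inr ⟨1, 2, by decide, hz, fun k hk1 hk2 => by
        fin_cases k <;> first | exact absurd rfl hk1 | exact absurd rfl hk2 | assumption⟩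
    · obtain ⟨hz, e1, e2, e3⟩ := h10
      exact Or.inr ⟨1, 3, by decide, hz, fun k hk1 hk2 => by
        fin_cases k <;> first | exact absurd rfl hk1 | exact absurd rfl hk2 | assumption⟩
    · obtain ⟨hz, e1, e2, e3⟩ := h11
      exact Or.inr ⟨1, 4, by decide, hz, fun k hk1 hk2 => by
        fin_cases k <;> first | exact absurd rfl hk1 | exact absurd rfl hk2 | assumption⟩
    · obtain ⟨hz, e1, e2, e3⟩ := h12
      exact Or.inr ⟨2, 3, by decide, hz, fun k hk1 hk2 => by
        fin_cases k <;> first | exact absurd rfl hk1 | exact absurd rfl hk2 | assumption⟩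
    · obtain ⟨hz, e1, e2, e3⟩ := h13
      exact Or.inr ⟨2, 4, by decide, hz, fun k hk1 hk2 => by
        fin_cases k <;> first | exact absurd rfl hk1 | exact absurd rfl hk2 | assumption⟩
    · obtain ⟨hz, e1, e2, e3⟩ := h14
      exact Or.inr ⟨3, 4, by decide, hz, fun k hk1 hk2 => by
        fin_cases k <;> first | exact absurd rfl hk1 | exact absurd rfl hk2 | assumption⟩
  rcases key with ⟨x, hx⟩ | ⟨x, y, hxy, hz, hk⟩
  · -- a star: `t_j = T/2` off `x`, hence `t_x = T - 4·T/2 = -T`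
    left
    refine ⟨x, (∑ i, t i) / 2, ?_, fun j hj => by linear_combination (-1/2 : ℂ) * hx j hj⟩
    have hcard : (univ.erase x).card = 4 := by
      rw [card_erase_of_mem (mem_univ x), card_univ, Fintype.card_fin]
    have hrest : ∑ j ∈ univ.erase x, t j = ∑ j ∈ univ.erase x, (∑ i, t i) / 2 :=
      sum_congr rfl fun j hj => by linear_combination (-1/2 : ℂ) * hx j (ne_of_mem_erase hj)
    rw [sum_const, hcard] at hrest
    have hsum : ∑ i, t i = t x + ∑ j ∈ univ.erase x, t j := (add_sum_erase _ _ (mem_univ x)).symm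
    rw [hrest] at hsum
    simp only [nsmul_eq_mul, Nat.cast_ofNat] at hsum
    linear_combination -hsum
  · -- a matching: `t_k = T/2` off `{x,y}` and `t_x + t_y = T`, hence `T = T + 3T/2`, `T = 0`
    right
    have hyx : y ∈ univ.erase x := mem_erase.mpr ⟨hxy.symm, mem_univ y⟩
    have hcard : ((univ.erase x).erase y).card = 3 := by
      rw [card_erase_of_mem hyx, card_erase_of_mem (mem_univ x), card_univ, Fintype.card_fin]
    have hrest : ∑ k ∈ (univ.erase x).erase y, t k = ∑ k ∈ (univ.erase x).erase y, (∑ i, t i) / 2 :=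
      sum_congr rfl fun k hk' => by
        linear_combination (-1/2 : ℂ) * hk k (ne_of_mem_erase (mem_of_mem_erase hk')) (ne_of_mem_erase hk')
    rw [sum_const, hcard] at hrest
    have hsum : ∑ i, t i = t x + (t y + ∑ k ∈ (univ.erase x).erase y, t k) := by
      rw [add_sum_erase _ _ hyx, add_sum_erase _ _ (mem_univ x)]
    rw [hrest] at hsum
    simp only [nsmul_eq_mul, Nat.cast_ofNat] at hsum
    have hS0 : ∑ i, t i = 0 := by linear_combination (-2/3 : ℂ) * hsum + (2/3 : ℂ) * hz
    refine ⟨x, y, hxy, fun k h1 h2 => by linear_combination (-1/2 : ℂ) * hk k h1 h2 + (1/2 : ℂ) * hS0,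
      by linear_combination -hz + hS0⟩

end Pencil5

end Summit.ValiantsHypothesis.ValiantsHypothesis.Theorems.RigidityForcesSymmetryRankRigidMinimalRepr
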